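import Literature.NumberTheory.Weil1964.ArchDualPairThetaMajorantsRankTwo
import Literature.NumberTheory.Automorphic.Liu2021.ThetaLiftFromLineMajorants
import HarnessLib

/-!
# [Weil1964, n° 41 Lemme 5 ∕ Thm. 6] Weil's theta majorants for `U(diag d_V) × U(⟨a⟩)` at the LINE splitting — first factor of
# signature `(N−2, 2)` at EVERY real place (the doubled frame of [Liu2021, App. B])

Topic `NumberTheory/Automorphic/Liu2021`; namespace `Literature.NumberTheory.Automorphic.Liu2021`.  THEOREMS ONLY.
Continuation of ★ `ThetaLiftFromLineMajorants`, which discharges the binder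
`hρ : HasThetaMajorants fun p Φ => pairRep L⁺ L c̄ N 1 e₁ (diagonal d_V) (J_W a) (chiSplittingLine … (T_W a) … (J_W a) …) p Φ`
from the sign facts «signature `(N−1, 1)` under `ι₁`, definite elsewhere» (the real pair `U(N−1,1) × U(1)`,
★ `LeviKAKInput.junction`).  Here the SAME binder for a frame `d_V` with exactly TWO negative entries and (at least) two named
positive ones through EVERY complex embedding — the real pair `U(N−2, 2) × U(1)` at every place, ★ `LeviKAKInput.junctionTwo`
(`ArchLeviKAKInputTwoPlanes`; word ★ `RealUnitaryKAKPair` over the every-rank Cartan decomposition ★ `RealUnitaryKAK`) through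
★ `Weil1964.hasThetaMajorants_cmPairSplitting_twoTwo`'s kind `nonempty_anyLeviKAKInput_cm_twoTwo` (trivial sign convention).
This is the profile of the DOUBLED frame `d_D = (d_V, −d_V)` of a definite hermitian plane (`N = 2 + 2`, signature `(2,2)` at
every real place): the hypothesis `hρ` of the rank-two doubling method ([Liu2021, App. B]; tree socket #42R, organ O42.9).

* `hasThetaMajorants_pairRep_line_twoTwo` — any compatible continuous splitting `s` of the line datum, any spelling
  `T_W = realDiagonal d_W`;
* `hasThetaMajorants_pairRep_chiSplittingLine_twoTwo` — at `s := chiSplittingLine … χ …`;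
* **`hasThetaMajorants_pairRep_chiSplittingLine_TW_twoTwo`** — the T5 spelling (Gram `T_W a`, form `J_W a`, `hJW := JW_eq`);
* **`hasThetaMajorants_lineThetaKernelDatum_twoTwo`** — its instance at `χ := toHeckeCharacter L μ`, `μ` conjugate-symplectic:
  the literal `hρ` of ★ `lineThetaKernelDatum L N e₁ dV hdV hdV0 μ hμ a hρ` ∕ of socket #42R (`N := n + n`, `dV := dD …`,
  `μ := λ⁻¹`, `a := a′ i`).

HONEST LABEL: HC_CM is proved only modulo the 2 remaining named inputs (hLiu418, h413) until rung 0 closes; this module asserts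
nothing of print — it re-uses the tree's proof of Weil's Lemme 5 at one more rank profile.

## References
* [Weil1964] A. Weil, *Sur certains groupes d'opérateurs unitaires*, Acta Math. 111 (1964), Chap. III n° 41 Lemme 5 p. 194, Thm. 6 (1) p. 193.
* [GelbartRogawski1991] S. Gelbart, J. Rogawski, Invent. Math. 105 (1991), §3.1 Prop. 3.1.1 p. 455.
* [Liu2021] Y. Liu, Camb. J. Math. 9 (2021) = arXiv:2102.11518, App. B (doubling), App. D §D.1 Steps 1–2.
* [KonnoKonno2007] T. Konno, K. Konno, Kyushu J. Math. 61 (2007), §3.1 (3.1).  [Knapp2002] Thm 7.39.  [Folland1989] §4.2.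
-/

set_option autoImplicit false

noncomputable section

open NumberField NumberField.InfinitePlace IsDedekindDomain
open scoped Matrix

namespace Literature.NumberTheory.Automorphic.Liu2021

open Literature.NumberTheory.Automorphic Literature.NumberTheory.Automorphic.UnitaryGroup
open Literature.NumberTheory.Automorphic.IdeleClassGroup
open Literature.NumberTheory.Automorphic.Liu2021.Def411WeilCarriers
open Literature.NumberTheory.Automorphic.Liu2021.Def411WeilCarriersDoubling
open Literature.NumberTheory.GelbartRogawski1991 Literature.NumberTheory.GelbartRogawski1991.UnitaryDualPair
open Literature.NumberTheory.Weil1964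
open Literature.NumberTheory.GaloisRepresentations (HeckeCharacter)
open Literature.RepresentationTheory.HarrisKudlaSweet1996 (IsSplittingChar)
open Literature.RepresentationTheory.Liu2021

variable (L : Type) [Field L] [NumberField L] [IsCMField L] {N n' : ℕ} (e₁ : Fin N × Fin 1 ≃ Fin n')
  (dV : Fin N → L) (hdV : ∀ i, IsCMField.complexConj L (dV i) = dV i) (hdV0 : ∀ i, dV i ≠ 0)

/-- for a LINE `⟨d_W⟩` the sign hypothesis of the majorant producer is automatic through every complex embedding. [folklore] -/
private theorem re_apply_line_pos_or_neg' (τ : L →+* ℂ) (dW : Fin 1 → L) (hdW : ∀ i, IsCMField.complexConj L (dW i) = dW i)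
    (hdW0 : ∀ i, dW i ≠ 0) : (∀ j, 0 < (τ (dW j)).re) ∨ ∀ j, (τ (dW j)).re < 0 :=
  (lt_or_gt_of_ne (re_apply_ne_zero_of_complexConj_eq L τ (hdW 0) (hdW0 0))).symm.imp
    (fun h j => by rwa [Subsingleton.elim j 0]) fun h j => by rwa [Subsingleton.elim j 0]

/-! ## §1 Any compatible continuous splitting of the line datum, first factor `(N−2, 2)` at every place -/

set_option maxHeartbeats 1600000 in
-- heartbeats: the `subst` runs through the `splittingDatum` telescope of the line datum (as in ★ `hasThetaMajorants_pairRep_line_of_signs`).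
/-- **Weil's majorants for ANY compatible continuous splitting of the line datum `(U(diag d_V), U(J_W))`, at any spelling `T_W` of the
line's real Gram matrix with `T_W = realDiagonal d_W`, first factor of signature `(N−2, 2)` at every real place**: through every complex
embedding `τ` the (real, non-zero) `re τ(d_V i)` are negative at two indices `i₀ ≠ i₁`, positive at two named indices `j₀ ≠ j₁` and
at every `i ∉ {i₀, i₁}`; the line's own sign facts are automatic.  Then `(u₁, u₂) ↦ ω_ψ(s_pair(u₁, u₂))` `HasThetaMajorants`
(★ `Weil1964.hasThetaMajorants_omega_pairSplitting_canonical` after `subst`, trivial sign convention, kind ★ `nonempty_anyLeviKAKInput_cm_twoTwo`).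
[cite: Weil1964, Chap. III n° 41 Lemme 5 p. 194, Thm. 6 (1) p. 193] [cite: GelbartRogawski1991, §3.1 Prop. 3.1.1 p. 455]
[cite: KonnoKonno2007, §3.1 (3.1)] -/
theorem hasThetaMajorants_pairRep_line_twoTwo (dW : Fin 1 → L) (hdW : ∀ i, IsCMField.complexConj L (dW i) = dW i)
    (hdW0 : ∀ i, dW i ≠ 0) (TW : Matrix (Fin 1) (Fin 1) ↥(maximalRealSubfield L)) (hTW : TW = realDiagonal L dW hdW)
    (hW : TW.IsSymm) (hWd : IsUnit TW.det) (JW : Matrix (Fin 1) (Fin 1) L)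
    (hJW : JW = TW.map (algebraMap (↥(maximalRealSubfield L)) L))
    {s : UnitaryGroup.adelicPair (↥(maximalRealSubfield L)) L (IsCMField.complexConj L) N 1 (Matrix.diagonal dV) JW →*
      adelicMpCont (↥(maximalRealSubfield L)) (Fin n') (adelicGram (↥(maximalRealSubfield L)) e₁ (realDiagonal L dV hdV) TW)}
    (hs : (splittingDatum (↥(maximalRealSubfield L)) L (IsCMField.complexConj L) N 1 e₁ (Matrix.diagonal dV) JW
      (complexConj_imagUnit L) (imagUnit_ne_zero L) (imagUnit_mul_self L) (realDiagonal_isSymm L dV hdV) hW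
      (isUnit_det_realDiagonal L dV hdV hdV0) hWd (realDiagonal_map L dV hdV).symm hJW).IsCompatible s)
    (hsc : Continuous s)
    (h22 : ∀ τ : L →+* ℂ, ∃ i₀ i₁ j₀ j₁ : Fin N, i₀ ≠ i₁ ∧ j₀ ≠ j₁ ∧ (τ (dV i₀)).re < 0 ∧ (τ (dV i₁)).re < 0 ∧
      0 < (τ (dV j₀)).re ∧ 0 < (τ (dV j₁)).re ∧ ∀ i, i ≠ i₀ → i ≠ i₁ → 0 < (τ (dV i)).re) :
    HasThetaMajorants fun
      (p : ↥(UnitaryGroup.adelic (↥(maximalRealSubfield L)) L (IsCMField.complexConj L) N (Matrix.diagonal dV)) ×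
        ↥(UnitaryGroup.adelic (↥(maximalRealSubfield L)) L (IsCMField.complexConj L) 1 JW))
      (Φ : piSchwartzBruhat (↥(maximalRealSubfield L)) (Fin n')) =>
        pairRep (↥(maximalRealSubfield L)) L (IsCMField.complexConj L) N 1 e₁ (Matrix.diagonal dV) JW s p Φ := by
  subst hTW
  exact hasThetaMajorants_omega_pairSplitting_canonical L (IsCMField.complexConj L) N 1 e₁ (cmRealVec L dV hdV) (cmRealVec L dW hdW)
    (realDiagonal_map L dV hdV).symm hJW (complexConj_imagUnit L) (imagUnit_ne_zero L) (imagUnit_mul_self L)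
    (realDiagonal_isSymm L dV hdV) hW (IsCMField.complexConj_ne_one L) (cmPlaceOver L) (cmPlaceOver_smul L) (cmPlaceOver_comap L)
    (fun _ => (1 : ℝ)) (fun _ => one_ne_zero) (isUnit_det_realDiagonal L dV hdV hdV0) hWd
    (nonempty_anyLeviKAKInput_cm_twoTwo L dV hdV dW hdW h22 fun τ => re_apply_line_pos_or_neg' L τ dW hdW hdW0)
    hs hsc

set_option maxHeartbeats 1600000 in
/-- **Weil's majorants at the line's `χ`-SPLITTING**, first factor `(N−2, 2)` at every place, any spelling `T_W = realDiagonal d_W`.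
[cite: Weil1964, Chap. III n° 41 Lemme 5 p. 194, Thm. 6 (1) p. 193] [cite: Liu2021, App. D §D.1 Steps 1–2 (l. 5217–5219)]
[cite: GelbartRogawski1991, §3.1 Prop. 3.1.1 p. 455] -/
theorem hasThetaMajorants_pairRep_chiSplittingLine_twoTwo (χ : HeckeCharacter L) (hχu : χ.IsUnitary) (hχs : IsSplittingChar L 1 χ)
    (dW : Fin 1 → L) (hdW : ∀ i, IsCMField.complexConj L (dW i) = dW i) (hdW0 : ∀ i, dW i ≠ 0)
    (TW : Matrix (Fin 1) (Fin 1) ↥(maximalRealSubfield L)) (hTW : TW = realDiagonal L dW hdW)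
    (hW : TW.IsSymm) (hWd : IsUnit TW.det) (JW : Matrix (Fin 1) (Fin 1) L)
    (hJW : JW = TW.map (algebraMap (↥(maximalRealSubfield L)) L))
    (h22 : ∀ τ : L →+* ℂ, ∃ i₀ i₁ j₀ j₁ : Fin N, i₀ ≠ i₁ ∧ j₀ ≠ j₁ ∧ (τ (dV i₀)).re < 0 ∧ (τ (dV i₁)).re < 0 ∧
      0 < (τ (dV j₀)).re ∧ 0 < (τ (dV j₁)).re ∧ ∀ i, i ≠ i₀ → i ≠ i₁ → 0 < (τ (dV i)).re) :
    HasThetaMajorants fun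
      (p : ↥(UnitaryGroup.adelic (↥(maximalRealSubfield L)) L (IsCMField.complexConj L) N (Matrix.diagonal dV)) ×
        ↥(UnitaryGroup.adelic (↥(maximalRealSubfield L)) L (IsCMField.complexConj L) 1 JW))
      (Φ : piSchwartzBruhat (↥(maximalRealSubfield L)) (Fin n')) =>
        pairRep (↥(maximalRealSubfield L)) L (IsCMField.complexConj L) N 1 e₁ (Matrix.diagonal dV) JW
          (chiSplittingLine L e₁ dV hdV hdV0 χ hχu hχs TW hWd JW hJW) p Φ :=
  hasThetaMajorants_pairRep_line_twoTwo L e₁ dV hdV hdV0 dW hdW hdW0 TW hTW hW hWd JW hJW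
    (isCompatible_chiSplittingLine L e₁ dV hdV hdV0 χ hχu hχs TW hW hWd JW hJW)
    (continuous_chiSplittingLine L e₁ dV hdV hdV0 χ hχu hχs TW hWd JW hJW) h22

/-! ## §2 The T5 ∕ #42R spelling: Gram `T_W a = !![a]`, form `J_W a`, `hJW := JW_eq` -/

set_option maxHeartbeats 1600000 in
/-- **THE BINDER `hρ` AT SIGNATURE `(N−2, 2)` — Weil's majorants for `pairRep … (diagonal d_V) (J_W a) (chiSplittingLine … χ … (T_W a) … (J_W a) (JW_eq …))`**
for every unitary splitting character `χ` of `L`, from the sign facts `h22` on `d_V` (two negative, two named positive, rest positive, at every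
complex embedding). [cite: Weil1964, Chap. III n° 41 Lemme 5 p. 194, Thm. 6 (1) p. 193] [cite: Liu2021, App. D §D.1 Steps 1–2 (l. 5215–5219)]
[cite: GelbartRogawski1991, §3.1 Prop. 3.1.1 p. 455] -/
theorem hasThetaMajorants_pairRep_chiSplittingLine_TW_twoTwo (χ : HeckeCharacter L) (hχu : χ.IsUnitary) (hχs : IsSplittingChar L 1 χ)
    (a : (↥(maximalRealSubfield L))ˣ)
    (h22 : ∀ τ : L →+* ℂ, ∃ i₀ i₁ j₀ j₁ : Fin N, i₀ ≠ i₁ ∧ j₀ ≠ j₁ ∧ (τ (dV i₀)).re < 0 ∧ (τ (dV i₁)).re < 0 ∧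
      0 < (τ (dV j₀)).re ∧ 0 < (τ (dV j₁)).re ∧ ∀ i, i ≠ i₀ → i ≠ i₁ → 0 < (τ (dV i)).re) :
    HasThetaMajorants fun
      (p : ↥(UnitaryGroup.adelic (↥(maximalRealSubfield L)) L (IsCMField.complexConj L) N (Matrix.diagonal dV)) ×
        ↥(UnitaryGroup.adelic (↥(maximalRealSubfield L)) L (IsCMField.complexConj L) 1 (JW (↥(maximalRealSubfield L)) L a)))
      (Φ : piSchwartzBruhat (↥(maximalRealSubfield L)) (Fin n')) =>
        pairRep (↥(maximalRealSubfield L)) L (IsCMField.complexConj L) N 1 e₁ (Matrix.diagonal dV) (JW (↥(maximalRealSubfield L)) L a)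
          (chiSplittingLine L e₁ dV hdV hdV0 χ hχu hχs (TW (↥(maximalRealSubfield L)) a)
            (isUnit_det_TW (↥(maximalRealSubfield L)) a) (JW (↥(maximalRealSubfield L)) L a) (JW_eq (↥(maximalRealSubfield L)) L a)) p Φ :=
  hasThetaMajorants_pairRep_chiSplittingLine_twoTwo L e₁ dV hdV hdV0 χ hχu hχs _ (complexConj_coe_realSubfield L a)
    (coe_realSubfield_ne_zero L a) (TW (↥(maximalRealSubfield L)) a) (TW_eq_realDiagonal L a) (isSymm_TW (↥(maximalRealSubfield L)) a)
    (isUnit_det_TW (↥(maximalRealSubfield L)) a) (JW (↥(maximalRealSubfield L)) L a) (JW_eq (↥(maximalRealSubfield L)) L a) h22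

set_option maxHeartbeats 1600000 in
/-- **the literal `hρ` of ★ `lineThetaKernelDatum L N e₁ dV hdV hdV0 μ hμ a hρ` ∕ of socket #42R at signature `(N−2, 2)`** (`χ := toHeckeCharacter L μ`,
`μ` conjugate-symplectic; for #42R: `N := n + n`, `dV := dD …`, `μ := λ⁻¹`, `a := a′ i`), from the sign facts `h22` on `d_V`.
[cite: Weil1964, Chap. III n° 41 Lemme 5 p. 194, Thm. 6 (1) p. 193] [cite: Liu2021, App. D §D.1 Steps 1–2 (l. 5215–5219)] -/
theorem hasThetaMajorants_lineThetaKernelDatum_twoTwo (μ : Literature.NumberTheory.Automorphic.IdeleClassGroup L →ₜ* Circle)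
    (hμ : IsConjugateSymplectic L μ) (a : (↥(maximalRealSubfield L))ˣ)
    (h22 : ∀ τ : L →+* ℂ, ∃ i₀ i₁ j₀ j₁ : Fin N, i₀ ≠ i₁ ∧ j₀ ≠ j₁ ∧ (τ (dV i₀)).re < 0 ∧ (τ (dV i₁)).re < 0 ∧
      0 < (τ (dV j₀)).re ∧ 0 < (τ (dV j₁)).re ∧ ∀ i, i ≠ i₀ → i ≠ i₁ → 0 < (τ (dV i)).re) :
    HasThetaMajorants fun
      (p : ↥(UnitaryGroup.adelic (↥(maximalRealSubfield L)) L (IsCMField.complexConj L) N (Matrix.diagonal dV)) ×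
        ↥(UnitaryGroup.adelic (↥(maximalRealSubfield L)) L (IsCMField.complexConj L) 1 (JW (↥(maximalRealSubfield L)) L a)))
      (Φ : piSchwartzBruhat (↥(maximalRealSubfield L)) (Fin n')) =>
        pairRep (↥(maximalRealSubfield L)) L (IsCMField.complexConj L) N 1 e₁ (Matrix.diagonal dV) (JW (↥(maximalRealSubfield L)) L a)
          (chiSplittingLine L e₁ dV hdV hdV0 (toHeckeCharacter L μ) (isUnitary_toHeckeCharacter L μ)
            ((isOscillatorChar_toHeckeCharacter_iff μ).mpr hμ) (TW (↥(maximalRealSubfield L)) a)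
            (isUnit_det_TW (↥(maximalRealSubfield L)) a) (JW (↥(maximalRealSubfield L)) L a) (JW_eq (↥(maximalRealSubfield L)) L a)) p Φ :=
  hasThetaMajorants_pairRep_chiSplittingLine_TW_twoTwo L e₁ dV hdV hdV0 (toHeckeCharacter L μ) (isUnitary_toHeckeCharacter L μ)
    ((isOscillatorChar_toHeckeCharacter_iff μ).mpr hμ) a h22

end Literature.NumberTheory.Automorphic.Liu2021

end
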